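import Summits.CriticalPhenomena.PercolationContinuityZ3.Theorems.PercNearOneGluingNoHeavyRsw3SlabSeal
import HarnessLib

/-!
# RSW3 lane (P2, gen 11): the SLAB SEAL at every integer aspect `k ≥ 6` — `σ₂(n)² · P_p((boxCross (n, 2n, kn) 1)ᶜ) ≤ P_p(2 ≤ N^sp((n, kn, kn), 0))`

builds on p205010 (kernel theorem, internal audit signed; external expert review pending)

Cell `prim-rsw3`, prover seat `prim-rsw3-p2` (gen 11), memo `run/shared/lean/prim/rsw3/P2-RSWLITE.md` §17.
Support file (`--supports stmt-CriticalPhenomena-4575`); no definitions, no named facts, no sorries.  The `k`-general form of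
`…Rsw3SlabSeal` (`k = 6`): for every `p`, every `k ≥ 6` and every `n ≥ 1`,

  `σ₂(n)² · P_p((boxCross (n, 2n, kn) 1)ᶜ) ≤ P_p(TwoSpan(S_k)) ≤ P_p(2 ≤ N^sp(S_k))`,  `S_k = {0..n} × {0..kn}² = Icc 0 (easyShape k n)`,

where `boxCross (n, 2n, kn) 1` is the crossing of the plate `{0..n} × {0..2n} × {0..kn}` along its side `2n`.  Same mechanism: the sub-blocks
`{0..n} × [0,2n] × [0,kn]` and `{0..n} × [4n,6n] × [0,kn]` of `S_k` (`k ≥ 6`) are crossed in direction `0` independently, each with probability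
`≥ σ₂(n)`; the edge-restricted seal of the layer `{0..n} × [2n,4n] × [0,kn]` against crossings along `x₁` keeps their spanning clusters apart
inside `S_k`.  Used by `…Rsw3SlabTwoSpanningCriticalGeneral` to prove Aizenman's `D_L(1/k, p_c) > 0` on `ℤ³` for every integer `k ≥ 6`.

References: M. Aizenman, Nucl. Phys. B 485 (1997) 551–582, §2 Thm. 2, Remark 2, criterion (ii) [Aizenman1997]; H. Kesten, *Percolation Theory
for Mathematicians* (1982), §3.3 Comment (v) [Kesten1982]; G. Grimmett, *Percolation* (1999), §1.6, §2.2, §7.3 [GrimmettPercolation1999]. [folklore]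
-/
noncomputable section

namespace Summit.CriticalPhenomena.PercolationContinuityZ3.Theorems

open MeasureTheory ProbabilityTheory Filter Topology
open Literature.Probability.Percolation Literature.Probability.LatticeModels
open Literature.Barriers.CriticalPhenomena

namespace Rsw3

open SurfaceTension Crossing

/-! ## Coordinates -/

/-- `easyShape k n = (n, kn, kn)` with integer entries. [cite: Kesten1982, (3.65)] -/
theorem easyShape_eq_vec3 (k n : ℕ) : easyShape k n = ![(n : ℤ), (k : ℤ) * (n : ℤ), (k : ℤ) * (n : ℤ)] := by
  ext j; fin_cases j <;> simp [easyShape]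

/-! ## The slab seal -/

/-- **The slab seal (every `p`, every `n ≥ 1`), `TwoSpan` form.**  With `S = Icc 0 (easyShape k n) = {0..n} × {0..kn}²`:
`P_p(boxCross (easyShape 2 n) 0)² · P_p((boxCross (n, 2n, kn) 1)ᶜ) ≤ P_p(TwoSpan(S))`, where `TwoSpan(S)` is the event that `S`
contains open lattice paths `x ↔ y`, `x' ↔ y'` inside `S` with `x₀ = x'₀ = 0`, `y₀ = y'₀ = n`, and `x ↮ x'` inside `S` (the
`inConn` form of "two spanning clusters" used by the lane's slab files).  Two independent thin-way crossings of
`{0..n} × [0,2n] × [0,kn]` and `{0..n} × [4n,6n] × [0,kn]`, and the edge-restricted seal of the layer `{0..n} × [2n,4n] × [0,kn]`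
against crossings along `x₁`. [cite: Aizenman1997, §2 Thm. 2 (D_L(t,p) and criterion (ii))] -/
theorem sq_mul_real_compl_boxCross_le_real_twoSpan_general (p : unitInterval) {k n : ℕ} (hk : 6 ≤ k) (hn : 1 ≤ n) :
    (bondPercolation (zdGraph 3) p).real (boxCross (easyShape 2 n) 0) ^ 2 *
        (bondPercolation (zdGraph 3) p).real (boxCross ![(n : ℤ), 2 * (n : ℤ), (k : ℤ) * (n : ℤ)] 1)ᶜ ≤
      (bondPercolation (zdGraph 3) p).real
        {ω : BondConfig (Site 3) | ∃ x ∈ Finset.Icc (0 : Site 3) (easyShape k n), ∃ x' ∈ Finset.Icc (0 : Site 3) (easyShape k n),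
            ∃ y ∈ Finset.Icc (0 : Site 3) (easyShape k n), ∃ y' ∈ Finset.Icc (0 : Site 3) (easyShape k n),
            x 0 = 0 ∧ x' 0 = 0 ∧ y 0 = (n : ℤ) ∧ y' 0 = (n : ℤ) ∧
            ω ∈ inConn ↑(Finset.Icc (0 : Site 3) (easyShape k n)) x y ∧
            ω ∈ inConn ↑(Finset.Icc (0 : Site 3) (easyShape k n)) x' y' ∧
            ω ∉ inConn ↑(Finset.Icc (0 : Site 3) (easyShape k n)) x x'} := by
  classical
  set μ := bondPercolation (zdGraph 3) p with hμ
  have hn1 : (1 : ℤ) ≤ n := by exact_mod_cast hn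
  have hkn : 6 * (n : ℤ) ≤ (k : ℤ) * (n : ℤ) := mul_le_mul_of_nonneg_right (by exact_mod_cast hk) (by positivity)
  -- the slab `S`, the plate / sub-block side vector `M = (n, 2n, kn)`, the translation `v₂ = (0, 4n, 0)` of `B₂`
  set S : Finset (Site 3) := Finset.Icc (0 : Site 3) (easyShape k n) with hS
  set M : Site 3 := ![(n : ℤ), 2 * (n : ℤ), (k : ℤ) * (n : ℤ)] with hM
  set blk : Finset (Site 3) := Finset.Icc (0 : Site 3) M with hblk
  set F0 : Set (Site 3) := {x | x ∈ blk ∧ x 0 = 0} with hF0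
  set F1 : Set (Site 3) := {x | x ∈ blk ∧ x 0 = M 0} with hF1
  set v₂ : Site 3 := ![(0 : ℤ), 4 * (n : ℤ), 0] with hv₂
  have hM0 : M 0 = n := by simp [hM]
  have hM1 : M 1 = 2 * (n : ℤ) := by simp [hM]
  have hM2 : M 2 = (k : ℤ) * (n : ℤ) := by simp [hM]
  have hv₂0 : v₂ 0 = 0 := by simp [hv₂]
  have hv₂1 : v₂ 1 = 4 * (n : ℤ) := by simp [hv₂]
  have hv₂2 : v₂ 2 = 0 := by simp [hv₂]
  have hmem_blk : ∀ x : Site 3, x ∈ blk ↔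
      (0 ≤ x 0 ∧ x 0 ≤ n) ∧ (0 ≤ x 1 ∧ x 1 ≤ 2 * (n : ℤ)) ∧ (0 ≤ x 2 ∧ x 2 ≤ (k : ℤ) * (n : ℤ)) := by
    intro x; rw [hblk, hM]; exact mem_Icc_zero_vec3_iff
  have hmem_S : ∀ x : Site 3, x ∈ S ↔
      (0 ≤ x 0 ∧ x 0 ≤ n) ∧ (0 ≤ x 1 ∧ x 1 ≤ (k : ℤ) * (n : ℤ)) ∧ (0 ≤ x 2 ∧ x 2 ≤ (k : ℤ) * (n : ℤ)) := by
    intro x; rw [hS, easyShape_eq_vec3]; exact mem_Icc_zero_vec3_iff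
  -- the two thin-way crossing events
  set C₁ : Set (BondConfig (Site 3)) := linked (↑blk : Set (Site 3)) F0 F1 with hC₁
  set C₂ : Set (BondConfig (Site 3)) :=
    linked ((zdShiftIso v₂) '' (↑blk : Set (Site 3))) ((zdShiftIso v₂) '' F0) ((zdShiftIso v₂) '' F1) with hC₂
  -- (1) probabilities: both `≥ σ₂(n)`
  have hσ₁ : μ.real (boxCross (easyShape 2 n) 0) ≤ μ.real C₁ := by
    have hmono : boxCross (easyShape 2 n) 0 ⊆ boxCross M 0 := by
      refine boxCross_mono ?_ ?_
      · intro j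
        fin_cases j
        · simp [easyShape, hM]
        · simp [easyShape, hM]
        · simp [easyShape, hM]; omega
      · simp [easyShape, hM]
    refine (measureReal_mono hmono (measure_ne_top _ _)).trans ?_
    rw [hC₁, hF0, hF1, hblk]
    exact real_boxCross_le_real_linked_faces p M 0
  have hσ₂ : μ.real (boxCross (easyShape 2 n) 0) ≤ μ.real C₂ := by
    have himg := real_linked_image (zdShiftIso v₂) p (↑blk : Set (Site 3)) F0 F1
    rw [← hμ] at himg
    have : μ.real C₂ = μ.real C₁ := by rw [hC₂, hC₁]; exact himg
    rw [this]; exact hσ₁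
  -- (2) locality of `C₁`, `C₂`
  have himg₂ : (zdShiftIso v₂) '' (↑blk : Set (Site 3)) = ↑(blk.image (· + v₂)) := by rw [Finset.coe_image]; rfl
  have hdet₁ : DeterminedBy C₁ (↑(edgesIn (zdGraph 3) blk) : Set (Sym2 (Site 3))) := determinedBy_linked_edgesIn _ _ _
  have hdet₂ : DeterminedBy C₂ (↑(edgesIn (zdGraph 3) (blk.image (· + v₂))) : Set (Sym2 (Site 3))) := by
    show DeterminedBy (linked ((zdShiftIso v₂) '' (↑blk : Set (Site 3))) ((zdShiftIso v₂) '' F0) ((zdShiftIso v₂) '' F1)) _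
    rw [himg₂]; exact determinedBy_linked_edgesIn _ _ _
  have hC₁m : MeasurableSet C₁ := measurableSet_linked _ _ _
  have hC₂m : MeasurableSet C₂ := measurableSet_linked _ _ _
  -- vertices of `blk` have `x₁ ≤ 2n`, of `blk + v₂` have `x₁ ≥ 4n`
  have hx1_blk : ∀ x ∈ blk, x 1 ≤ 2 * (n : ℤ) := fun x hx => ((hmem_blk x).1 hx).2.1.2
  have hx1_v₂ : ∀ x ∈ blk.image (· + v₂), 4 * (n : ℤ) ≤ x 1 := by
    intro x hx
    rw [Finset.mem_image] at hx
    obtain ⟨y, hy, rfl⟩ := hx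
    have := ((hmem_blk y).1 hy).2.1.1
    simp only [Pi.add_apply, hv₂1]; omega
  -- (3) the plate `L = v_L + [0, M]`, its crossing event `X` along `x₁`, the edge class `T`, the seal `W`
  set vL : Site 3 := ![(0 : ℤ), 2 * (n : ℤ), 0] with hvL
  have hvL0 : vL 0 = 0 := by simp [hvL]
  have hvL1 : vL 1 = 2 * (n : ℤ) := by simp [hvL]
  have hvL2 : vL 2 = 0 := by simp [hvL]
  set R : Set (Site 3) := {x | ∀ j, vL j ≤ x j ∧ x j ≤ vL j + M j} with hR
  set A : Set (Site 3) := {x | x ∈ R ∧ x 1 = vL 1} with hA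
  set B : Set (Site 3) := {x | x 1 = vL 1 + M 1} with hB
  set X : Set (BondConfig (Site 3)) := linked R A B with hX
  set T : Set (Sym2 (Site 3)) := {e | ∃ x ∈ e, 2 * (n : ℤ) < x 1 ∧ x 1 < 4 * (n : ℤ)} with hT
  set W : Set (BondConfig (Site 3)) := {ω | ω ∩ T ∉ X} with hW
  have hWT : DeterminedBy W T := by
    rw [determinedBy_iff]
    intro ω ω' h
    simp only [hW, Set.mem_setOf_eq, h]
  have hmeas : Measurable fun ω : BondConfig (Site 3) => ω ∩ T :=
    measurable_set_iff.2 fun e => (measurable_set_mem e).and measurable_const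
  have hXm : MeasurableSet X := measurableSet_linked R A B
  have hWm : MeasurableSet W := by
    have : W = (fun ω : BondConfig (Site 3) => ω ∩ T) ⁻¹' Xᶜ := rfl
    rw [this]
    exact hXm.compl.preimage hmeas
  -- membership in `R` from the coordinate bounds
  have hmemR : ∀ x : Site 3, x ∈ S → 2 * (n : ℤ) ≤ x 1 → x 1 ≤ 4 * (n : ℤ) → x ∈ R := by
    intro x hx h1 h2
    obtain ⟨⟨h00, h01⟩, -, ⟨h20, h21⟩⟩ := (hmem_S x).1 hx
    intro j
    fin_cases j
    · show vL 0 ≤ x 0 ∧ x 0 ≤ vL 0 + M 0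
      rw [hvL0, hM0]; omega
    · show vL 1 ≤ x 1 ∧ x 1 ≤ vL 1 + M 1
      rw [hvL1, hM1]; omega
    · show vL 2 ≤ x 2 ∧ x 2 ≤ vL 2 + M 2
      rw [hvL2, hM2]; omega
  -- (4) disjointness of the three edge classes
  have hdisj12 : Disjoint (↑(edgesIn (zdGraph 3) blk) : Set (Sym2 (Site 3))) ↑(edgesIn (zdGraph 3) (blk.image (· + v₂))) := by
    refine disjoint_edgesIn_of_disjoint (Finset.disjoint_left.2 fun x hx hx' => ?_)
    have h1 := hx1_blk x hx; have h2 := hx1_v₂ x hx'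
    omega
  have hdisj1T : Disjoint (↑(edgesIn (zdGraph 3) blk) : Set (Sym2 (Site 3))) T := by
    rw [Set.disjoint_left]
    intro e he heT
    rw [Finset.mem_coe, mem_edgesIn_iff] at he
    obtain ⟨x, hxe, hx⟩ := heT
    have := hx1_blk x (he.2 x hxe)
    omega
  have hdisj2T : Disjoint (↑(edgesIn (zdGraph 3) (blk.image (· + v₂))) : Set (Sym2 (Site 3))) T := by
    rw [Set.disjoint_left]
    intro e he heT
    rw [Finset.mem_coe, mem_edgesIn_iff] at he
    obtain ⟨x, hxe, hx⟩ := heT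
    have := hx1_v₂ x (he.2 x hxe)
    omega
  -- (5) independence
  have hind12 : μ.real (C₁ ∩ C₂) = μ.real C₁ * μ.real C₂ :=
    bondPercolation_real_inter_of_disjoint (zdGraph 3) p hdisj12 hdet₁ hdet₂ hC₁m hC₂m
  have hdet12 : DeterminedBy (C₁ ∩ C₂)
      ((↑(edgesIn (zdGraph 3) blk) : Set (Sym2 (Site 3))) ∪ ↑(edgesIn (zdGraph 3) (blk.image (· + v₂)))) :=
    (hdet₁.mono Set.subset_union_left).inter (hdet₂.mono Set.subset_union_right)
  have hind : μ.real (C₁ ∩ C₂ ∩ W) = μ.real C₁ * μ.real C₂ * μ.real W := by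
    rw [bondPercolation_real_inter_of_disjoint (zdGraph 3) p (Disjoint.union_left hdisj1T hdisj2T) hdet12 hWT
        (hC₁m.inter hC₂m) hWm, ← hμ, hind12]
  -- (6) the kill property of the seal: on `W`, no open path of `S` joins `{x₁ ≤ 2n}` to `{x₁ ≥ 4n}`
  have hkill : ∀ ω, ω ∈ W → ∀ a b : Site 3, a ∈ S → a 1 ≤ 2 * (n : ℤ) → 4 * (n : ℤ) ≤ b 1 →
      ¬ (openGraph ω ⊓ withinGraph (zdGraph 3) (↑S : Set (Site 3))).Reachable a b := by
    intro ω hWω a b haS ha hb hab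
    apply hWω
    set H := openGraph ω ⊓ withinGraph (zdGraph 3) (↑S : Set (Site 3)) with hH
    have hHle : H ≤ zdGraph 3 := fun x y hxy => (withinGraph_adj.1 hxy.2).1
    have hHS : H ≤ withinGraph (zdGraph 3) (↑S : Set (Site 3)) := inf_le_right
    obtain ⟨Wk⟩ := hab
    -- every vertex of the walk lies in `S`
    have hmemS : ∀ r, Wk.getVert r ∈ S := fun r =>
      Finset.mem_coe.1 (getVert_mem_of_le_withinGraph hHS Wk (Finset.mem_coe.2 haS) r)
    -- `s` = first index with `x₁ ≥ 4n`
    have hex_s : ∃ s : ℕ, 4 * (n : ℤ) ≤ Wk.getVert s 1 := ⟨Wk.length, by rw [Wk.getVert_length]; exact hb⟩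
    set s := Nat.find hex_s with hs
    have hs_ge : 4 * (n : ℤ) ≤ Wk.getVert s 1 := Nat.find_spec hex_s
    have hs_len : s ≤ Wk.length := Nat.find_min' hex_s (by rw [Wk.getVert_length]; exact hb)
    have hs_lt : ∀ r, r < s → Wk.getVert r 1 < 4 * (n : ℤ) := fun r hr => by
      have := Nat.find_min hex_s hr; push Not at this; exact this
    have hs_pos : 0 < s := by
      by_contra h0
      have h0' : s = 0 := by omega
      have := hs_ge
      rw [h0', Wk.getVert_zero] at this
      omega
    have hs_eq : Wk.getVert s 1 = 4 * (n : ℤ) := by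
      refine le_antisymm ?_ hs_ge
      obtain ⟨s', hs'⟩ : ∃ s', s = s' + 1 := ⟨s - 1, by omega⟩
      have hadj : H.Adj (Wk.getVert s') (Wk.getVert (s' + 1)) := Wk.adj_getVert_succ (by omega)
      have h1 := (coord_sub_le_one_of_adj (hHle hadj) 1).2
      have h2 := hs_lt s' (by omega)
      rw [hs']
      omega
    -- `t` = last index `≤ s` with `x₁ ≤ 2n`
    set t := Nat.findGreatest (fun r => Wk.getVert r 1 ≤ 2 * (n : ℤ)) s with ht
    have ht_le2 : Wk.getVert t 1 ≤ 2 * (n : ℤ) :=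
      Nat.findGreatest_spec (P := fun r => Wk.getVert r 1 ≤ 2 * (n : ℤ)) (Nat.zero_le s)
        (by rw [Wk.getVert_zero]; exact ha)
    have ht_le : t ≤ s := Nat.findGreatest_le s
    have ht_gt : ∀ r, t < r → r ≤ s → 2 * (n : ℤ) < Wk.getVert r 1 := by
      intro r hr hrs
      have := Nat.findGreatest_is_greatest (P := fun r => Wk.getVert r 1 ≤ 2 * (n : ℤ)) hr hrs
      push Not at this; exact this
    have ht_lt : t < s := by
      rcases ht_le.lt_or_eq with h | h
      · exact h
      · exfalso; rw [h, hs_eq] at ht_le2; omega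
    have ht_eq : Wk.getVert t 1 = 2 * (n : ℤ) := by
      refine le_antisymm ht_le2 ?_
      have hadj : H.Adj (Wk.getVert t) (Wk.getVert (t + 1)) := Wk.adj_getVert_succ (by omega)
      have h1 := (coord_sub_le_one_of_adj (hHle hadj) 1).2
      have h2 := ht_gt (t + 1) (by omega) (by omega)
      omega
    have ht2 : t + 1 < s := by
      by_contra hle
      have hts : s = t + 1 := by omega
      have hadj : H.Adj (Wk.getVert t) (Wk.getVert (t + 1)) := Wk.adj_getVert_succ (by omega)
      have h1 := (coord_sub_le_one_of_adj (hHle hadj) 1).2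
      rw [← hts, hs_eq, ht_eq] at h1
      omega
    -- every vertex with index in `[t, s]` lies in `R`
    have hR_of : ∀ r, t ≤ r → r ≤ s → Wk.getVert r ∈ R := by
      intro r htr hrs
      refine hmemR _ (hmemS r) ?_ ?_
      · rcases htr.lt_or_eq with h | h
        · exact (ht_gt r h hrs).le
        · rw [← h, ht_eq]
      · rcases hrs.lt_or_eq with h | h
        · exact (hs_lt r h).le
        · rw [h, hs_eq]
    -- adjacency in the restricted graph along `[t, s]`
    set H' := openGraph (ω ∩ T) ⊓ withinGraph (zdGraph 3) R with hH'
    have hadj' : ∀ r, t ≤ r → r < s → H'.Adj (Wk.getVert r) (Wk.getVert (r + 1)) := by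
      intro r htr hrs
      have hadj := Wk.adj_getVert_succ (i := r) (by omega)
      obtain ⟨hopen, hwithin⟩ := (SimpleGraph.inf_adj _ _ _ _).1 hadj
      rw [withinGraph_adj] at hwithin
      obtain ⟨he, hne⟩ := (openGraph_adj ω _ _).1 hopen
      have hTmem : s(Wk.getVert r, Wk.getVert (r + 1)) ∈ T := by
        rcases htr.lt_or_eq with h | h
        · exact ⟨Wk.getVert r, Sym2.mem_mk_left _ _, ht_gt r h (by omega), hs_lt r hrs⟩
        · exact ⟨Wk.getVert (r + 1), Sym2.mem_mk_right _ _, ht_gt (r + 1) (by omega) (by omega),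
            hs_lt (r + 1) (by omega)⟩
      refine (SimpleGraph.inf_adj _ _ _ _).2 ⟨(openGraph_adj _ _ _).2 ⟨⟨he, hTmem⟩, hne⟩, ?_⟩
      rw [withinGraph_adj]
      exact ⟨hwithin.1, hR_of r htr (by omega), hR_of (r + 1) (by omega) (by omega)⟩
    have hreach : ∀ j, t + j ≤ s → H'.Reachable (Wk.getVert t) (Wk.getVert (t + j)) := by
      intro j
      induction j with
      | zero => intro _; exact SimpleGraph.Reachable.refl _
      | succ j ih =>
        intro hj
        have h1 := ih (by omega)
        have h2 := (hadj' (t + j) (by omega) (by omega)).reachable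
        rw [← add_assoc]
        exact h1.trans h2
    have hts : H'.Reachable (Wk.getVert t) (Wk.getVert s) := by
      have := hreach (s - t) (by omega)
      rwa [Nat.add_sub_cancel' ht_le] at this
    -- conclude: `ω ∩ T ∈ X`
    rw [hX, mem_linked_iff]
    refine ⟨Wk.getVert t, ⟨hR_of t le_rfl ht_le, by rw [ht_eq, hvL1]⟩, Wk.getVert s,
      by show Wk.getVert s 1 = vL 1 + M 1; rw [hs_eq, hvL1, hM1]; ring, ?_⟩
    rw [mem_inConn_iff]
    exact hts
  -- (7) the inclusion `C₁ ∩ C₂ ∩ W ⊆ TwoSpan(S)`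
  have hblk_S : (↑blk : Set (Site 3)) ⊆ ↑S := by
    intro x hx
    rw [Finset.mem_coe] at hx ⊢
    obtain ⟨h0, h1, h2⟩ := (hmem_blk x).1 hx
    exact (hmem_S x).2 ⟨h0, ⟨h1.1, by omega⟩, h2⟩
  have hblk₂_S : (zdShiftIso v₂) '' (↑blk : Set (Site 3)) ⊆ ↑S := by
    rintro _ ⟨y, hy, rfl⟩
    rw [Finset.mem_coe] at hy
    obtain ⟨h0, h1, h2⟩ := (hmem_blk y).1 hy
    rw [Finset.mem_coe, hmem_S]
    simp only [zdShiftIso_apply, Pi.add_apply, hv₂0, hv₂1, hv₂2]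
    omega
  have hincl : ∀ ω, ω ∈ C₁ ∩ C₂ ∩ W →
      ω ∈ {ω : BondConfig (Site 3) | ∃ x ∈ S, ∃ x' ∈ S, ∃ y ∈ S, ∃ y' ∈ S,
            x 0 = 0 ∧ x' 0 = 0 ∧ y 0 = (n : ℤ) ∧ y' 0 = (n : ℤ) ∧
            ω ∈ inConn ↑S x y ∧ ω ∈ inConn ↑S x' y' ∧ ω ∉ inConn ↑S x x'} := by
    rintro ω ⟨⟨h₁, h₂⟩, hWω⟩
    -- the crossing of `B₁`
    have h₁' : ω ∈ linked (↑blk : Set (Site 3)) F0 F1 := h₁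
    rw [mem_linked_iff] at h₁'
    obtain ⟨a, ⟨ha, ha0⟩, b, ⟨hb, hb0⟩, hab⟩ := h₁'
    -- the crossing of `B₂`
    have h₂' : ω ∈ linked ((zdShiftIso v₂) '' (↑blk : Set (Site 3))) ((zdShiftIso v₂) '' F0)
        ((zdShiftIso v₂) '' F1) := h₂
    rw [mem_linked_iff] at h₂'
    obtain ⟨_, ⟨a₀, ⟨ha₀, ha₀0⟩, rfl⟩, _, ⟨b₀, ⟨hb₀, hb₀0⟩, rfl⟩, hab'⟩ := h₂'
    rw [hM0] at hb0 hb₀0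
    have haS : a ∈ S := Finset.mem_coe.1 (hblk_S (Finset.mem_coe.2 ha))
    have hbS : b ∈ S := Finset.mem_coe.1 (hblk_S (Finset.mem_coe.2 hb))
    have ha'S : (zdShiftIso v₂) a₀ ∈ S := Finset.mem_coe.1 (hblk₂_S ⟨a₀, Finset.mem_coe.2 ha₀, rfl⟩)
    have hb'S : (zdShiftIso v₂) b₀ ∈ S := Finset.mem_coe.1 (hblk₂_S ⟨b₀, Finset.mem_coe.2 hb₀, rfl⟩)
    refine ⟨a, haS, (zdShiftIso v₂) a₀, ha'S, b, hbS, (zdShiftIso v₂) b₀, hb'S, ha0, ?_, hb0, ?_,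
      inConn_mono hblk_S _ _ hab, inConn_mono hblk₂_S _ _ hab', ?_⟩
    · rw [zdShiftIso_apply, Pi.add_apply, ha₀0, hv₂0]; ring
    · rw [zdShiftIso_apply, Pi.add_apply, hb₀0, hv₂0]; ring
    · intro hconn
      rw [mem_inConn_iff] at hconn
      refine hkill ω hWω a ((zdShiftIso v₂) a₀) haS (hx1_blk a ha) ?_ hconn
      refine hx1_v₂ _ ?_
      rw [Finset.mem_image]
      exact ⟨a₀, ha₀, by rw [zdShiftIso_apply]⟩
  -- (8) `P(W) ≥ 1 - P(X) ≥ P((boxCross M 1)ᶜ)`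
  have hXW : Xᶜ ⊆ W := by
    intro ω hω hωT
    exact hω (isUpperSet_linked R A B (Set.inter_subset_left : ω ∩ T ⊆ ω) hωT)
  have hM1' : (0 : ℤ) ≤ M 1 := by rw [hM1]; positivity
  have hXle : μ.real X ≤ μ.real (boxCross M 1) :=
    real_linked_le_real_boxCross p (R := R) (A := A) (B := B) (v := vL) (M := M) (L := M) 1
      (fun x hx => hx) (fun x hx => hx.1) (fun x hx => hx.2) (fun x hx => hx) hM1' le_rfl (fun j _ => le_rfl)
  have hXc : μ.real Xᶜ = 1 - μ.real X := probReal_compl_eq_one_sub hXm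
  have hBc : μ.real (boxCross M 1)ᶜ = 1 - μ.real (boxCross M 1) := probReal_compl_eq_one_sub (measurableSet_boxCross M 1)
  have hXW' : μ.real Xᶜ ≤ μ.real W := measureReal_mono hXW (measure_ne_top μ W)
  have hcompl : μ.real (boxCross M 1)ᶜ ≤ μ.real W := by rw [hBc]; rw [hXc] at hXW'; linarith
  -- (9) conclusion
  have hle : μ.real (C₁ ∩ C₂ ∩ W) ≤ μ.real
      {ω : BondConfig (Site 3) | ∃ x ∈ S, ∃ x' ∈ S, ∃ y ∈ S, ∃ y' ∈ S,
        x 0 = 0 ∧ x' 0 = 0 ∧ y 0 = (n : ℤ) ∧ y' 0 = (n : ℤ) ∧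
        ω ∈ inConn ↑S x y ∧ ω ∈ inConn ↑S x' y' ∧ ω ∉ inConn ↑S x x'} :=
    measureReal_mono (fun ω hω => hincl ω hω) (measure_ne_top _ _)
  rw [hind] at hle
  have h0 : 0 ≤ μ.real (boxCross (easyShape 2 n) 0) := measureReal_nonneg
  have hW0 : 0 ≤ μ.real W := measureReal_nonneg
  calc μ.real (boxCross (easyShape 2 n) 0) ^ 2 * μ.real (boxCross M 1)ᶜ
      ≤ μ.real C₁ * μ.real C₂ * μ.real W := by
        rw [sq]
        exact mul_le_mul (mul_le_mul hσ₁ hσ₂ h0 measureReal_nonneg) hcompl measureReal_nonneg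
          (mul_nonneg measureReal_nonneg measureReal_nonneg)
    _ ≤ _ := hle

/-- **The slab seal, counting form: `σ₂(n)² · P_p((boxCross (n, 2n, kn) 1)ᶜ) ≤ P_p(2 ≤ N^sp((n,kn,kn), 0))`** for every `p` and
every `n ≥ 1` (`N^sp = Crossing.blockSpanningCount (easyShape k n) 0`, Aizenman's free-b.c. count of spanning clusters of the
slab-box `{0..n} × {0..kn}²`).  At `p_c(ℤ³)`, where `σ₂ ≥ c_E`, this reads: if two spanning clusters are rare at scale `n`, the
plates `{0..n} × {0..2n} × {0..6n}` are crossed along their side `2n` with probability `≥ 1 - P(2 ≤ N^sp)/c_E²`.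
[cite: Aizenman1997, §2 Thm. 2 and §5 (N_Free)] -/
theorem sq_mul_real_compl_boxCross_le_real_two_le_blockSpanningCount_general (p : unitInterval) {k n : ℕ} (hk : 6 ≤ k)
    (hn : 1 ≤ n) :
    (bondPercolation (zdGraph 3) p).real (boxCross (easyShape 2 n) 0) ^ 2 *
        (bondPercolation (zdGraph 3) p).real (boxCross ![(n : ℤ), 2 * (n : ℤ), (k : ℤ) * (n : ℤ)] 1)ᶜ ≤
      (bondPercolation (zdGraph 3) p).real {ω | 2 ≤ blockSpanningCount (easyShape k n) 0 ω} :=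
  (sq_mul_real_compl_boxCross_le_real_twoSpan_general p hk hn).trans
    (real_twoSpan_le_real_two_le_blockSpanningCount p (L := easyShape k n) (n := n) (by simp [easyShape]))

end Rsw3

end Summit.CriticalPhenomena.PercolationContinuityZ3.Theorems

end
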